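import Literature.MathematicalPhysics.QuantumFieldTheory.Balaban1983to89.B16Sect1AnalyticExt
import Literature.MathematicalPhysics.QuantumFieldTheory.Balaban1983to89.B15Prop1Minimum

/-!
# `Balaban1983to89.B16Eq139CriticalPoint` — T. Bałaban, *Large field renormalization. II. Localization, exponentiation,
and bounds for the 𝐑 operation*, Commun. Math. Phys. **122** (1989) 355–392 [Balaban1989LargeFieldII] («[LF-II]»),
Sect. 1 pp. 366–367: **the criticality (1.39) of the function `V′_Λ` defined by (1.38), the derivation of Eq. (1.40) from
it, and the formula (1.42)** — PROVED (theorems only) at the two levels on which the tree types these displays: the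
`ExtData` carrier of `…B16Sect1AnalyticExt` at its (1.38) instance `with138`, and r13's real-Hilbert model of the printed
expansion argument (pp. 359/367: `…B16Eq112`, `…B16Sect1AnalyticExt.eq140_iff`, `…B16Prop1IVAssembly`, r12's
`…B15Prop1Minimum`).  SKELETON rows **B16.Eq1.39, B16.Eq1.40, B16.Eq1.42** (owner r13; the members named in the owner
audit `lit-balaban-r13/READING-RULE-AUDIT-B16-g100.md` §4); mega-formalization `lit-balaban`, reader/typer block r13
gen 101; HOME `run/shared/lean/pub/lit-balaban/`, rows `lit-balaban-r13/ROWS-B16.md`.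

statement-level skeleton of published theorems with citation tags; proofs where landed; nothing here is a claim about
the Yang–Mills mass gap

PDF held: `paper:balaban1989-cmp122-large-field-ii` (journal page = PDF page + 354); pp. 366–367 [PDF 12–13] and
pp. 357, 359 [PDF 3, 5] re-read by this seat (text layer, r13 gen 101; the x2 renders
`run/shared/lean/pub/pub-balaban/b2b-balaban-ref1/pages/1989-cmp122-large-field-II/…-p012,p013-x2.png` were read as images
by r13 gens 4/10 for `B16Sect1AnalyticExt`/`B16Ineq141Solution`).  [IV] = [Balaban1989LargeFieldI].

WHAT IS PRINTED (pp. 366–367, verbatim).  *«We would like to establish an identity of the form V_Λ(M^k(𝐔)) =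
V′_Λ(M̃^k(U′))V_Λ(M^k(U)), (1.38) holding in the axial gauge, and to prove analyticity properties and bounds for the
function V′_Λ. Of course the identity is a definition of this function, so the bounds are important. We may replace also
the kth averages by fields Ṽ′, V, satisfying proper smallness, or regularity conditions. The function V′_Λ is determined
as a critical point of the function V′↾_Λ → A(U_{k,Z}(Ṽ′V, V′V_Λ(V))), (1.39) where V′ = exp iB′, and B′ is sufficiently
small. We expand the above function with respect to (B′, B̃′), B̃′ = (1/i) log Ṽ′. The expansion has the same form as the
one in the exponentials in (1.2), only with ζ₀ = 1 and g_k = 1. Differentiating it with respect to B′, using the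
criticality condition for U₀ = U_{k,Z}(V, V_Λ(V)), and inverting the linear operator as in (1.13), we obtain the equation
B′ + (P₀H*_{1,k}Δ₁H_{1,k}P₀)⁻¹P₀H*_{1,k}((δ/δA)V)(H_{1,k}B′ + H_{1,k}B̃′) = −(P₀H*_{1,k}Δ₁H_{1,k}P₀)⁻¹P₀H*_{1,k}Δ₁H_{1,k}B̃′.
(1.40) … We can prove again that Eq. (1.40) has exactly one solution B′_Λ(B̃′), which is an analytic function of the
𝔤ᶜ-valued small field B̃′, satisfying the bound (1.41). This yields the formula V′_Λ(M̃^k(U′)) = exp iB′_Λ((1/i) log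
M̃^k(U′)) (1.42) for the function in the identity (1.38)»*.  The «criticality condition for U₀» is (1.4)–(1.5) p. 357:
*«⟨δA, J₀⟩ = 0 for all δA … In particular, the above condition is satisfied for all δA with supp δA ⊂ Λ, therefore J₀ = 0
on Λ. The functions δA = H_{1,k}B′ satisfy also the condition in (1.4), therefore ⟨H_{1,k}B′, J₀⟩ = 0»*; the minimum behind
(1.39) is [IV] Prop. 1 p. 194: *«An element of the orbit is a minimum of the function»* (of the function (1.77) [IV]
`V_Λ ↦ A(U_{k,Z}(V_k↾_{Z∩Λᶜ}, V_Λ))`, whose minimiser IS `V_Λ(V_k↾)`).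

WHY `V′_Λ` IS CRITICAL (the one-line mathematics print leaves to the reader, and what this file makes kernel).  With
(1.38) read as the definition `V′_Λ(Ṽ′; V) = V_Λ(Ṽ′V)·V_Λ(V)⁻¹` (`ExtData.VΛ'138`, r13 gen 100), the (1.39) function along
the exponential chart through `V′_Λ` is `t ↦ A(U_{k,Z}(Ṽ′V, [exp(itδB)·V′_Λ]·V_Λ(V))) = A(U_{k,Z}(Ṽ′V, exp(itδB)·V_Λ(Ṽ′V)))`
(bondwise group law) — the [IV] (1.77) function at the field `Ṽ′V` along the chart through ITS minimiser `V_Λ(Ṽ′V)`.  A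
minimum is a critical point (Fermat), so `V′_Λ` is a critical point of (1.39); in the chart `V′ = exp iB′` on the gauge-fixed
ball this criticality is the (1.12)-type variational equation whose current term vanishes by (1.4)–(1.5), i.e. — after
inverting `P₀H*Δ₁HP₀` — Eq. (1.40); and since (1.40) has exactly one small solution `B′_Λ(B̃′)`, the chart coordinate of
`V′_Λ(Ṽ′)` IS `B′_Λ((1/i) log Ṽ′)`: formula (1.42).

WHAT IS HERE (every `theorem` PROVED; theorems only — no `def`, no `… : Prop` fact, no `sorry`, no axiom).
§1 ON THE `ExtData` CARRIER (rows B16.Eq1.39 / 1.42 at the instance `with138`).  `mulCfg_expMul` (bondwise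
associativity `[exp(iA)·X]·Y = exp(iA)·[X·Y]`); `mulCfg_VΛ'138` (`V′_Λ·V_Λ(V) = V_Λ(Ṽ′V)`, (1.38) read backwards);
**`fun139_expMul_VΛ'138`** (the (1.39) function through the chart at `V′_Λ` = the (1.77) [IV] function through the chart at
`V_Λ(Ṽ′V)`); `isMinOn_fun139_VΛ'138` («determined as a critical point» in its strong form: `V′_Λ` MINIMISES (1.39) wherever
`V_Λ(Ṽ′V)` minimises (1.77) [IV], the constraint transported through `X = V′·V_Λ(V)`); **`def139_with138_of_isLocalMin`** —
the row-1.39 `Prop` `ExtData.Def139` (criticality `IsCritAt` along every chart direction, `HasDerivAt … 0 0`) PROVED at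
`with138 E` from [IV] Prop. 1's minimum clause along the chart lines through `V_Λ(Ṽ′V)` (`IsLocalMin`, hypothesis `hmin`)
and the differentiability of the action along them (hypothesis `hdiff`; print: analyticity, [IV] Prop. 1 / p. 366), by
Fermat's theorem (Mathlib `IsLocalMin.hasDerivAt_eq_zero`); `def139_with138_of_forall_le` (the same from plain
minimality over all `X`); **`eq142_with138_of_unique`** — the row-1.42 `Prop` `ExtData.Eq142 B′_Λ` at `with138 E` from
«exactly one solution»: if on each fibre the (1.39) function has at most one critical point in a set `S` of small
gauge-fixed `V′` containing both `V′_Λ(Ṽ′; V)` and `exp iB′_Λ((1/i) log Ṽ′)`, the latter critical (row B16.Eq1.41), then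
`V′_Λ = exp iB′_Λ((1/i) log ·)` on the domain.
§2 IN THE REAL-HILBERT MODEL OF pp. 359/367 (r13's letters: `E` ∋ `B′` gauge-fixed fields on `Λ` with the gauge
projection `P₀`, `F` ∋ fields `A` on `T_η`, `H = H_{1,k}`, `Hst = H*_{1,k}` with `⟨Hx, y⟩ = ⟨x, H*y⟩`, `Δ₁ = Δ₁(ζ₀ = 1)`,
`dV = (δ/δA)V`, the current `J = J₀` of `U₀`, `Kinv = (P₀H*Δ₁HP₀)⁻¹` on `P₀E`; `Bt = B̃′`).
`hasDerivAt_eq_zero_of_isLocalMinOn_gauge` / `hasDerivAt_eq_zero_of_isMinOn_gaugeBall` (FERMAT ON THE GAUGE SUBSPACE /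
BALL: a gauge-fixed local minimiser of `Φ` among the gauge-fixed configurations — in particular a gauge-fixed `B` with
`‖B‖ < r` minimising `Φ` over `{B′ | P₀B′ = B′, ‖B′‖ ≤ r}` — has vanishing derivative along every gauge direction); `hasDerivAt_expansion139` («The
expansion has the same form as the one in the exponentials in (1.2), only with ζ₀ = 1 and g_k = 1»: the function
`B′ ↦ a₀ + ⟨H(B′ + B̃′), J⟩ + ½⟨H(B′ + B̃′), Δ₁H(B′ + B̃′)⟩ + V(H(B′ + B̃′))` HAS the first variation `hΦ` used below — r12's
`B15Prop1Minimum.hasDerivAt_expansion` BY NAME at the shifted point); **`critical140_of_isMinOn`** («Differentiating it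
with respect to B′, using the criticality condition for U₀»: the gauge-fixed interior minimiser satisfies
`⟨δB′, H*Δ₁HB̃′⟩ + ⟨δB′, H*Δ₁HB′⟩ + ⟨δB′, H*(δ/δA)V(HB′ + HB̃′)⟩ = 0` for all gauge `δB′`, the current term being killed
by `hJ : ⟨HδB′, J₀⟩ = 0`); **`eq140_of_isMinOn`** («and inverting the linear operator as in (1.13), we obtain the
equation (1.40)» — `B16Sect1AnalyticExt.eq140_iff` BY NAME); `lipschitz140_of_bounds` + **`solution140_unique_real`**
(«exactly one solution» over `ℝ`: two solutions of (1.40) in a ball on which `B′ ↦ K⁻¹P₀H*(δ/δA)V(HB′ + HB̃′)` is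
½-Lipschitz coincide; the Lipschitz property from the operator letters `κ₁`, `h₁`, `ℓ` with `κ₁ℓh₁ ≤ ½` exactly as in
`B16Ineq141Solution`, whose `ℂ`-analytic solution map `B̃′ ↦ B′_Λ(B̃′)` is row B16.Eq1.41); **`eq142_model`** — (1.42) IN
CHART COORDINATES: the chart coordinate `B = (1/i) log V′_Λ(exp iB̃′)` (a gauge-fixed interior minimiser of the (1.39)
expansion — hypotheses, see HONEST SCOPE) EQUALS any solution `B′_Λ(B̃′)` of (1.40) in the uniqueness ball.

HONEST SCOPE.  (i) As in every r13/r12 file of this model, neither `A(U_{k,Z}(·,·))`, the chart, `H_{1,k}`, `Δ₁`, `V`, `J₀`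
nor `V_Λ` are constructed: §1 works over the explicit-data record `ExtData` (solution map, chart, `V ↦ V_Λ(V)`, … as
fields), §2 over abstract operators with the printed relations; the two levels are NOT connected by a kernel theorem
(that is the one-carrier instantiation, HOME/`lit-balaban-r13/B16-CLOSURE.md` §3, XL).  (ii) [IV] Prop. 1's minimum clause enters §1 as
the hypothesis `hmin` (local minimality of `X ↦ A(U_{k,Z}(Ṽ′V, X))` at `V_Λ(Ṽ′V)` along every chart line — for the
axial-gauge directions this is the printed clause, for directions along the gauge orbit it is the gauge invariance of the
action [I] (1.7)); its kernel theorem in the §2 model is r12's `B15Prop1Minimum.le_of_critical`; in §2 the minimiser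
property of the chart coordinate of `V′_Λ` is likewise the hypothesis `hmin` (transport of (ii) through the bijection
`X = V′·V_Λ(V)`, which §1 proves at the carrier level, `isMinOn_fun139_VΛ'138`).  (iii) Differentiability along the chart
(`hdiff`) is print's analyticity («V_Λ is an analytic function of the field V_k», p. 366), not proved here.  (iv) Print
determines `V′_Λ` for 𝔤ᶜ-valued `B̃′` by criticality + uniqueness (analytic extension); minimality makes sense for
`G`-valued fields only, which is where this file derives criticality — for complex arguments criticality is the definition
and (1.42) is row B16.Eq1.41's analytic solution map.  Nothing printed is asserted as a fact.
-/

namespace Literature.MathematicalPhysics.QuantumFieldTheory.Balaban1983to89.B16Eq139CriticalPoint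

open B16Sect1Backgrounds B16Sect1AnalyticExt B15DeterminingSets GaugeField
open Filter Set

variable {P : Params}

/-! ## §1 On the `ExtData` carrier: (1.39) and (1.42) at the (1.38) instance `with138` -/

section Carrier

variable {G : Type*} [GaugeGroup G] {av : ∀ i, Averaging P i G} {𝔤 : Type*} [AddCommGroup 𝔤] [Module ℝ 𝔤]

/-- Bondwise associativity of the group law: `[exp(iA)·X]·Y = exp(iA)·[X·Y]` — moving the chart factor of `V′ = exp(iB′)V′_Λ`
past the fixed field `V_Λ(V)` in the argument `V′V_Λ(V)` of (1.39). [cite: Balaban1989LargeFieldII, (1.39) p.366] -/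
theorem mulCfg_expMul (ch : ExpChart G 𝔤) {j : ℕ} (A : VecField P j 𝔤) (X Y : GaugeField P j G) :
    mulCfg (expMul ch A X) Y = expMul ch A (mulCfg X Y) := by
  funext b
  simp [mulCfg, expMul, mul_assoc]

variable (E : ExtData P G av 𝔤)

/-- (1.38) read backwards: `V′_Λ(Ṽ′; V)·V_Λ(V) = V_Λ(Ṽ′V)` for the function WITH ITS BODY `ExtData.VΛ'138`
(*«Of course the identity is a definition of this function»*). [cite: Balaban1989LargeFieldII, (1.38) p.366] -/
theorem mulCfg_VΛ'138 (Vt V : GaugeField P E.k G) :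
    mulCfg (E.VΛ'138 Vt V) (E.VΛmap V) = E.VΛmap (mulCfg Vt V) := by
  funext b
  simp [mulCfg, invCfg, ExtData.VΛ'138]

/-- The value of the (1.39) function AT `V′_Λ`: `A(U_{k,Z}(Ṽ′V, V′_Λ·V_Λ(V))) = A(U_{k,Z}(Ṽ′V, V_Λ(Ṽ′V)))` — the value of the
(1.77) [IV] function `X ↦ A(U_{k,Z}(Ṽ′V, X))` at its minimiser `V_Λ(Ṽ′V)`. [cite: Balaban1989LargeFieldII, (1.39) p.366] -/
theorem fun139_VΛ'138 (Vt V : GaugeField P E.k G) :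
    E.fun139 Vt V (E.VΛ'138 Vt V) = wilsonAction4 (E.UkZ2 (mulCfg Vt V) (E.VΛmap (mulCfg Vt V))) := by
  simp only [ExtData.fun139, mulCfg_VΛ'138]

/-- **The (1.39) function along the chart through `V′_Λ` IS the (1.77) [IV] function along the chart through its
minimiser**: `A(U_{k,Z}(Ṽ′V, [exp(iA)·V′_Λ]·V_Λ(V))) = A(U_{k,Z}(Ṽ′V, exp(iA)·V_Λ(Ṽ′V)))` for every chart field `A` (bondwise
group law + (1.38) as the definition of `V′_Λ`). [cite: Balaban1989LargeFieldII, (1.39) p.366] -/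
theorem fun139_expMul_VΛ'138 (Vt V : GaugeField P E.k G) (A : VecField P E.k 𝔤) :
    E.fun139 Vt V (expMul E.ch A (E.VΛ'138 Vt V)) =
      wilsonAction4 (E.UkZ2 (mulCfg Vt V) (expMul E.ch A (E.VΛmap (mulCfg Vt V)))) := by
  simp only [ExtData.fun139, mulCfg_expMul, mulCfg_VΛ'138]

/-- *«The function V′_Λ is determined as a critical point of the function V′↾_Λ → A(U_{k,Z}(Ṽ′V, V′V_Λ(V))) (1.39)»* in its
strong form, PROVED: wherever `V_Λ(Ṽ′V)` MINIMISES the (1.77) [IV] function `X ↦ A(U_{k,Z}(Ṽ′V, X))` on a set `S` of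
configurations ([IV] Prop. 1: *«An element of the orbit is a minimum of the function»*), the (1.38)-defined `V′_Λ(Ṽ′; V)`
minimises the (1.39) function on the transported set `{V′ | V′·V_Λ(V) ∈ S}`. [cite: Balaban1989LargeFieldII, (1.39)
p.366; Balaban1989LargeFieldI, Prop. 1 p.194] -/
theorem isMinOn_fun139_VΛ'138 {Vt V : GaugeField P E.k G} {S : Set (GaugeField P E.k G)}
    (hmin : IsMinOn (fun X => wilsonAction4 (E.UkZ2 (mulCfg Vt V) X)) S (E.VΛmap (mulCfg Vt V))) :
    IsMinOn (E.fun139 Vt V) {V' | mulCfg V' (E.VΛmap V) ∈ S} (E.VΛ'138 Vt V) := by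
  refine isMinOn_iff.2 fun V' hV' => ?_
  rw [fun139_VΛ'138]
  exact isMinOn_iff.1 hmin (mulCfg V' (E.VΛmap V)) hV'

/-- **Row B16.Eq1.39 — the criticality `ExtData.Def139` PROVED at the (1.38) instance `with138 E`.**  Hypotheses, per
point `𝐔 = U′U` of the domain (`Ṽ′ = M̃^k(U′)`, `V = M^k(U)`) and per chart direction `δB`: `hmin` — `t = 0` is a local
minimum of `t ↦ A(U_{k,Z}(Ṽ′V, exp(itδB)·V_Λ(Ṽ′V)))` ([IV] Prop. 1's minimum clause for the (1.77) function at the field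
`Ṽ′V`, *«We may replace also the kth averages by fields Ṽ′, V, satisfying proper smallness, or regularity conditions»*;
along gauge-orbit directions = gauge invariance of the action); `hdiff` — that function is differentiable at `t = 0`
(print: analyticity of `V_Λ`, p. 366 / [IV] Prop. 1).  Conclusion: for every `𝐔` of the domain and every `δB`, the
(1.39) function `V′ ↦ A(U_{k,Z}(Ṽ′V, V′V_Λ(V)))` has derivative `0` at `t = 0` along `t ↦ exp(itδB)·V′_Λ(Ṽ′; V)` —
Fermat's theorem applied through `fun139_expMul_VΛ'138`. [cite: Balaban1989LargeFieldII, (1.39) p.366; Balaban1989LargeFieldI,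
Prop. 1 p.194] -/
theorem def139_with138_of_isLocalMin
    (hmin : ∀ UU ∈ E.dom, ∀ δB : VecField P E.k 𝔤,
      IsLocalMin (fun t : ℝ => wilsonAction4 (E.UkZ2 (mulCfg (E.Mt UU.1) (E.Mk UU.2))
        (expMul E.ch (t • δB) (E.VΛmap (mulCfg (E.Mt UU.1) (E.Mk UU.2)))))) 0)
    (hdiff : ∀ UU ∈ E.dom, ∀ δB : VecField P E.k 𝔤,
      DifferentiableAt ℝ (fun t : ℝ => wilsonAction4 (E.UkZ2 (mulCfg (E.Mt UU.1) (E.Mk UU.2))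
        (expMul E.ch (t • δB) (E.VΛmap (mulCfg (E.Mt UU.1) (E.Mk UU.2)))))) 0) :
    E.with138.Def139 := by
  intro UU hUU δB
  show HasDerivAt (fun t : ℝ => E.fun139 (E.Mt UU.1) (E.Mk UU.2)
    (expMul E.ch (t • δB) (E.VΛ'138 (E.Mt UU.1) (E.Mk UU.2)))) 0 0
  simp only [fun139_expMul_VΛ'138]
  have hd := (hdiff UU hUU δB).hasDerivAt
  have h0 := (hmin UU hUU δB).hasDerivAt_eq_zero hd
  rwa [h0] at hd

/-- Row B16.Eq1.39 from PLAIN minimality: if `V_Λ(Ṽ′V)` minimises `X ↦ A(U_{k,Z}(Ṽ′V, X))` over all configurations `X` at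
every point of the domain ([IV] Prop. 1 read globally) and the action is differentiable along the chart lines, then
`ExtData.Def139` holds at `with138 E`. [cite: Balaban1989LargeFieldII, (1.39) p.366; Balaban1989LargeFieldI, Prop. 1 p.194] -/
theorem def139_with138_of_forall_le
    (hmin : ∀ UU ∈ E.dom, ∀ X : GaugeField P E.k G,
      wilsonAction4 (E.UkZ2 (mulCfg (E.Mt UU.1) (E.Mk UU.2)) (E.VΛmap (mulCfg (E.Mt UU.1) (E.Mk UU.2)))) ≤
        wilsonAction4 (E.UkZ2 (mulCfg (E.Mt UU.1) (E.Mk UU.2)) X))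
    (hdiff : ∀ UU ∈ E.dom, ∀ δB : VecField P E.k 𝔤,
      DifferentiableAt ℝ (fun t : ℝ => wilsonAction4 (E.UkZ2 (mulCfg (E.Mt UU.1) (E.Mk UU.2))
        (expMul E.ch (t • δB) (E.VΛmap (mulCfg (E.Mt UU.1) (E.Mk UU.2)))))) 0) :
    E.with138.Def139 := by
  refine def139_with138_of_isLocalMin E (fun UU hUU δB => ?_) hdiff
  refine Filter.Eventually.of_forall fun t => ?_
  have h := hmin UU hUU (expMul E.ch (t • δB) (E.VΛmap (mulCfg (E.Mt UU.1) (E.Mk UU.2))))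
  simpa only [zero_smul, expMul_zero] using h

/-- **Row B16.Eq1.42 — `ExtData.Eq142 B′_Λ` at the (1.38) instance `with138 E` from «exactly one solution».**  Per point
`𝐔` of the domain let `S 𝐔` be a set of small gauge-fixed configurations `V′` (the ball of (1.41)) in which the (1.39)
function has AT MOST ONE critical point (`huniq`; print: *«Eq. (1.40) has exactly one solution B′_Λ(B̃′)»*, the critical
points of (1.39) in the chart being the solutions of (1.40) — §2 below), containing `V′_Λ(Ṽ′; V)` (`hmem`; smallness of
`V′_Λ`, (1.41)/(1.45)) and the configuration `exp iB′_Λ((1/i) log Ṽ′)` of the formula, the latter critical (`hsol`; row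
B16.Eq1.41).  With the criticality of `V′_Λ` (`h139`, `def139_with138_of_isLocalMin`): *«This yields the formula
V′_Λ(M̃^k(U′)) = exp iB′_Λ((1/i) log M̃^k(U′)) (1.42) for the function in the identity (1.38)»*. [cite: Balaban1989LargeFieldII,
(1.42) p.367] -/
theorem eq142_with138_of_unique (BΛ : VecField P E.k 𝔤 → VecField P E.k 𝔤)
    (S : GaugeField P 0 G × GaugeField P 0 G → Set (GaugeField P E.k G)) (h139 : E.with138.Def139)
    (hmem : ∀ UU ∈ E.dom, E.VΛ'138 (E.Mt UU.1) (E.Mk UU.2) ∈ S UU)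
    (hsol : ∀ UU ∈ E.dom, E.VΛ142 BΛ (E.Mt UU.1) ∈ S UU ∧
      E.IsCritAt (E.fun139 (E.Mt UU.1) (E.Mk UU.2)) (E.VΛ142 BΛ (E.Mt UU.1)))
    (huniq : ∀ UU ∈ E.dom, ∀ V₁ ∈ S UU, ∀ V₂ ∈ S UU,
      E.IsCritAt (E.fun139 (E.Mt UU.1) (E.Mk UU.2)) V₁ →
        E.IsCritAt (E.fun139 (E.Mt UU.1) (E.Mk UU.2)) V₂ → V₁ = V₂) :
    E.with138.Eq142 BΛ := by
  rw [ExtData.eq142_with138_iff]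
  intro UU hUU
  have hcrit : E.IsCritAt (E.fun139 (E.Mt UU.1) (E.Mk UU.2)) (E.VΛ'138 (E.Mt UU.1) (E.Mk UU.2)) := h139 UU hUU
  exact huniq UU hUU _ (hmem UU hUU) _ (hsol UU hUU).1 hcrit (hsol UU hUU).2

end Carrier

/-! ## §2 In the real-Hilbert model of pp. 359/367: critical point ⇒ (1.40) ⇒ (1.42) -/

section Model

open scoped RealInnerProductSpace

variable {E F : Type*} [NormedAddCommGroup E] [InnerProductSpace ℝ E]
  [NormedAddCommGroup F] [InnerProductSpace ℝ F]

/-- **Fermat's theorem on the gauge subspace (local form).**  If `B` is gauge-fixed (`P₀B = B`) and a local minimum of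
`Φ` AMONG THE GAUGE-FIXED CONFIGURATIONS (`IsLocalMinOn Φ {B′ | P₀B′ = B′} B` — *«Fixing the gauge G₀ for V′»*, p. 359;
*«An element of the orbit is a minimum of the function»*, [IV] Prop. 1), then the derivative of `Φ` at `B` along every gauge
direction `δ` (`P₀δ = δ`) vanishes: the line `s ↦ B + sδ` runs inside the gauge subspace, so `s = 0` is a local minimum of
`s ↦ Φ(B + sδ)`. [cite: Balaban1989LargeFieldII, (1.39) p.366; Balaban1989LargeFieldI, Prop. 1 p.194] -/
theorem hasDerivAt_eq_zero_of_isLocalMinOn_gauge {P₀ : E →ₗ[ℝ] E} {Φ : E → ℝ} {B : E}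
    (hBg : P₀ B = B) (hmin : IsLocalMinOn Φ {B' : E | P₀ B' = B'} B)
    {δ : E} (hδ : P₀ δ = δ) {D : ℝ} (hD : HasDerivAt (fun s : ℝ => Φ (B + s • δ)) D 0) : D = 0 := by
  have hmaps : ∀ s : ℝ, B + s • δ ∈ {B' : E | P₀ B' = B'} := fun s => by
    show P₀ (B + s • δ) = B + s • δ
    rw [map_add, map_smul, hBg, hδ]
  have hcont : Tendsto (fun s : ℝ => B + s • δ) (nhds 0) (nhds B) := by
    have hc : Continuous (fun s : ℝ => B + s • δ) := by fun_prop
    have h := hc.tendsto 0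
    simp only [zero_smul, add_zero] at h
    exact h
  have ht : Tendsto (fun s : ℝ => B + s • δ) (nhds 0) (nhdsWithin B {B' : E | P₀ B' = B'}) :=
    tendsto_nhdsWithin_iff.2 ⟨hcont, Filter.Eventually.of_forall hmaps⟩
  have hev : ∀ᶠ s in nhds (0 : ℝ), Φ B ≤ Φ (B + s • δ) := ht.eventually hmin
  have hloc : IsLocalMin (fun s : ℝ => Φ (B + s • δ)) 0 :=
    hev.mono fun s hs => by simpa only [zero_smul, add_zero] using hs
  exact hloc.hasDerivAt_eq_zero hD

/-- **Fermat's theorem on the gauge ball.**  If `B` lies in the gauge subspace (`P₀B = B`) STRICTLY inside the ball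
(`‖B‖ < r`, *«B′ is sufficiently small»*) and minimises `Φ` over the gauge-fixed configurations of the closed ball
`{B′ | P₀B′ = B′, ‖B′‖ ≤ r}`, then the derivative of `Φ` at `B` along every gauge direction `δ` (`P₀δ = δ`) vanishes: the
segment `B + sδ` stays gauge-fixed and, for `|s|` small, inside the ball, so `s = 0` is a local minimum of `s ↦ Φ(B + sδ)`.
[cite: Balaban1989LargeFieldII, (1.39) p.366] -/
theorem hasDerivAt_eq_zero_of_isMinOn_gaugeBall {P₀ : E →ₗ[ℝ] E} {Φ : E → ℝ} {B : E} {r : ℝ}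
    (hBg : P₀ B = B) (hBr : ‖B‖ < r) (hmin : IsMinOn Φ {B' : E | P₀ B' = B' ∧ ‖B'‖ ≤ r} B)
    {δ : E} (hδ : P₀ δ = δ) {D : ℝ} (hD : HasDerivAt (fun s : ℝ => Φ (B + s • δ)) D 0) : D = 0 := by
  have hloc : IsLocalMin (fun s : ℝ => Φ (B + s • δ)) 0 := by
    have hgap : 0 < r - ‖B‖ := sub_pos.2 hBr
    have hε : 0 < (r - ‖B‖) / (‖δ‖ + 1) := div_pos hgap (by positivity)
    filter_upwards [Metric.ball_mem_nhds (0 : ℝ) hε] with s hs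
    rw [Metric.mem_ball, dist_zero_right, Real.norm_eq_abs] at hs
    have hmem : B + s • δ ∈ {B' : E | P₀ B' = B' ∧ ‖B'‖ ≤ r} := by
      refine ⟨by rw [map_add, map_smul, hBg, hδ], ?_⟩
      have h1 : |s| * ‖δ‖ ≤ (r - ‖B‖) / (‖δ‖ + 1) * ‖δ‖ :=
        mul_le_mul_of_nonneg_right hs.le (norm_nonneg δ)
      have h2 : (r - ‖B‖) / (‖δ‖ + 1) * ‖δ‖ ≤ (r - ‖B‖) / (‖δ‖ + 1) * (‖δ‖ + 1) :=
        mul_le_mul_of_nonneg_left (by linarith) hε.le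
      have h3 : (r - ‖B‖) / (‖δ‖ + 1) * (‖δ‖ + 1) = r - ‖B‖ := div_mul_cancel₀ _ (by positivity)
      calc ‖B + s • δ‖ ≤ ‖B‖ + ‖s • δ‖ := norm_add_le _ _
        _ = ‖B‖ + |s| * ‖δ‖ := by rw [norm_smul, Real.norm_eq_abs]
        _ ≤ ‖B‖ + (r - ‖B‖) := by linarith
        _ = r := by ring
    have hle := isMinOn_iff.1 hmin (B + s • δ) hmem
    simpa only [zero_smul, add_zero] using hle
  exact hloc.hasDerivAt_eq_zero hD

/-- *«The expansion has the same form as the one in the exponentials in (1.2), only with ζ₀ = 1 and g_k = 1»* — the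
(1.39) function in the chart, `B′ ↦ a₀ + ⟨H(B′ + B̃′), J⟩ + ½⟨H(B′ + B̃′), Δ₁H(B′ + B̃′)⟩ + V(H(B′ + B̃′))` (constant + current
term + quadratic form + higher order, the joint field `B′ + B̃′` transported by `H = H_{1,k}`: *«we should write H_{1,k,Z}
instead of H_{1,k} and Q_{𝐁(Z)}Q_k^{s*}B̃′ instead of B̃′, but it does not matter»*), with `Δ₁` symmetric and `dV` the
Gateaux gradient of `V`, HAS the first variation at `B′ = X` in the direction `δ` equal to
`⟨δ, H*J⟩ + ⟨δ, H*Δ₁HB̃′⟩ + ⟨δ, H*Δ₁HX⟩ + ⟨δ, H*(δ/δA)V(HX + HB̃′)⟩` — the hypothesis `hΦ` of `critical140_of_isMinOn` is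
inhabited by the printed function (r12's `B15Prop1Minimum.hasDerivAt_expansion` at the shifted point `X + B̃′`).
[cite: Balaban1989LargeFieldII, (1.40) p.367] -/
theorem hasDerivAt_expansion139 (H : E →ₗ[ℝ] F) (Hst : F →ₗ[ℝ] E)
    (hadj : ∀ (x : E) (y : F), ⟪H x, y⟫ = ⟪x, Hst y⟫) (Δ₁ : F →ₗ[ℝ] F)
    (hΔ : ∀ u w : F, ⟪Δ₁ u, w⟫ = ⟪u, Δ₁ w⟫) {V : F → ℝ} {dV : F → F}
    (hV : ∀ u w : F, HasDerivAt (fun s : ℝ => V (u + s • w)) ⟪w, dV u⟫ 0) (a₀ : ℝ) (J : F) (Bt X δ : E) :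
    HasDerivAt (fun s : ℝ => a₀ + ⟪H (X + s • δ + Bt), J⟫
        + 1 / 2 * ⟪H (X + s • δ + Bt), Δ₁ (H (X + s • δ + Bt))⟫ + V (H (X + s • δ + Bt)))
      (⟪δ, Hst J⟫ + ⟪δ, Hst (Δ₁ (H Bt))⟫ + ⟪δ, Hst (Δ₁ (H X))⟫ + ⟪δ, Hst (dV (H X + H Bt))⟫) 0 := by
  have h := B15Prop1Minimum.hasDerivAt_expansion H Hst hadj Δ₁ hΔ hV a₀ J (X + Bt) δ
  have hfun : (fun s : ℝ => a₀ + ⟪H (X + s • δ + Bt), J⟫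
      + 1 / 2 * ⟪H (X + s • δ + Bt), Δ₁ (H (X + s • δ + Bt))⟫ + V (H (X + s • δ + Bt))) =
      fun s : ℝ => a₀ + ⟪H (X + Bt + s • δ), J⟫
      + 1 / 2 * ⟪H (X + Bt + s • δ), Δ₁ (H (X + Bt + s • δ))⟫ + V (H (X + Bt + s • δ)) := by
    funext s
    rw [add_right_comm X (s • δ) Bt]
  have hval : ⟪δ, Hst J⟫ + ⟪δ, Hst (Δ₁ (H Bt))⟫ + ⟪δ, Hst (Δ₁ (H X))⟫ + ⟪δ, Hst (dV (H X + H Bt))⟫ =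
      ⟪δ, Hst J⟫ + ⟪δ, Hst (Δ₁ (H (X + Bt)))⟫ + ⟪δ, Hst (dV (H (X + Bt)))⟫ := by
    simp only [map_add, inner_add_right]
    ring
  rw [hfun, hval]
  exact h

/-- **«Differentiating it with respect to B′, using the criticality condition for U₀ = U_{k,Z}(V, V_Λ(V))»** — PROVED: let
`Φ` be the (1.39) function in the chart `V′ = exp iB′` at a fixed `B̃′ = Bt`, with the first variation of its printed
expansion (`hΦ`, cf. `hasDerivAt_expansion139`), and let the current term vanish on the gauge variations,
`⟨HδB′, J₀⟩ = 0` (`hJ` = (1.4)–(1.5) p. 357: *«J₀ = 0 on Λ … ⟨H_{1,k}B′, J₀⟩ = 0»*).  If the chart coordinate `B` of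
`V′_Λ(Ṽ′)` is a gauge-fixed configuration strictly inside the ball of radius `r` minimising `Φ` over the gauge-fixed
configurations of that ball (*«determined as a critical point of the function (1.39)»* via [IV] Prop. 1, §1), then `B`
satisfies the variational equation `⟨δB′, H*Δ₁HB̃′⟩ + ⟨δB′, H*Δ₁HB⟩ + ⟨δB′, H*(δ/δA)V(HB + HB̃′)⟩ = 0` for every gauge
variation `δB′` — the left member of `B16Sect1AnalyticExt.eq140_iff`. [cite: Balaban1989LargeFieldII, (1.40) p.367] -/
theorem critical140_of_isMinOn {P₀ : E →ₗ[ℝ] E} (H : E →ₗ[ℝ] F) (Hst : F →ₗ[ℝ] E)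
    (hadj : ∀ (x : E) (y : F), ⟪H x, y⟫ = ⟪x, Hst y⟫) (Δ₁ : F →ₗ[ℝ] F) (dV : F → F) (J : F) (Bt : E)
    {Φ : E → ℝ}
    (hΦ : ∀ X δ : E, HasDerivAt (fun s : ℝ => Φ (X + s • δ))
      (⟪δ, Hst J⟫ + ⟪δ, Hst (Δ₁ (H Bt))⟫ + ⟪δ, Hst (Δ₁ (H X))⟫ + ⟪δ, Hst (dV (H X + H Bt))⟫) 0)
    (hJ : ∀ δ : E, P₀ δ = δ → ⟪H δ, J⟫ = 0)
    {B : E} {r : ℝ} (hBg : P₀ B = B) (hBr : ‖B‖ < r)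
    (hmin : IsMinOn Φ {B' : E | P₀ B' = B' ∧ ‖B'‖ ≤ r} B) :
    ∀ δB : E, P₀ δB = δB →
      ⟪δB, Hst (Δ₁ (H Bt))⟫ + ⟪δB, Hst (Δ₁ (H B))⟫ + ⟪δB, Hst (dV (H B + H Bt))⟫ = 0 := by
  intro δB hδ
  have h0 := hasDerivAt_eq_zero_of_isMinOn_gaugeBall hBg hBr hmin hδ (hΦ B δB)
  have hJ' : ⟪δB, Hst J⟫ = 0 := by rw [← hadj]; exact hJ δB hδ
  linarith

/-- **Row B16.Eq1.40 DERIVED: «… and inverting the linear operator as in (1.13), we obtain the equation (1.40)»** — the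
chart coordinate `B` of `V′_Λ(Ṽ′)` (gauge-fixed interior minimiser of the (1.39) function, as in `critical140_of_isMinOn`)
satisfies `B + (P₀H*Δ₁HP₀)⁻¹P₀H*((δ/δA)V)(HB + HB̃′) = −(P₀H*Δ₁HP₀)⁻¹P₀H*Δ₁HB̃′` (the inverse `Kinv` on the gauge subspace as
in `B16Eq112`; `B16Sect1AnalyticExt.eq140_iff` BY NAME). [cite: Balaban1989LargeFieldII, (1.40) p.367] -/
theorem eq140_of_isMinOn {P₀ : E →ₗ[ℝ] E} (hP2 : ∀ x, P₀ (P₀ x) = P₀ x) (hPsa : ∀ x y, ⟪P₀ x, y⟫ = ⟪x, P₀ y⟫)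
    (H : E →ₗ[ℝ] F) (Hst : F →ₗ[ℝ] E) (hadj : ∀ (x : E) (y : F), ⟪H x, y⟫ = ⟪x, Hst y⟫)
    (Δ₁ : F →ₗ[ℝ] F) (dV : F → F) (J : F) (Bt : E) {Kinv : E →ₗ[ℝ] E}
    (hKl : ∀ x, Kinv (P₀ (Hst (Δ₁ (H (P₀ x))))) = P₀ x) (hKr : ∀ x, P₀ (Hst (Δ₁ (H (P₀ (Kinv x))))) = P₀ x)
    (hKP : ∀ x, Kinv (P₀ x) = Kinv x) {Φ : E → ℝ}
    (hΦ : ∀ X δ : E, HasDerivAt (fun s : ℝ => Φ (X + s • δ))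
      (⟪δ, Hst J⟫ + ⟪δ, Hst (Δ₁ (H Bt))⟫ + ⟪δ, Hst (Δ₁ (H X))⟫ + ⟪δ, Hst (dV (H X + H Bt))⟫) 0)
    (hJ : ∀ δ : E, P₀ δ = δ → ⟪H δ, J⟫ = 0)
    {B : E} {r : ℝ} (hBg : P₀ B = B) (hBr : ‖B‖ < r)
    (hmin : IsMinOn Φ {B' : E | P₀ B' = B' ∧ ‖B'‖ ≤ r} B) :
    B + Kinv (P₀ (Hst (dV (H B + H Bt)))) = -Kinv (P₀ (Hst (Δ₁ (H Bt)))) :=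
  (B16Sect1AnalyticExt.eq140_iff hP2 hPsa H Hst Δ₁ dV Bt hKl hKr hKP hBg).1
    (critical140_of_isMinOn H Hst hadj Δ₁ dV J Bt hΦ hJ hBg hBr hmin)

/-- The contraction letter of (1.40) from the printed operator bounds (as in `B16Prop1IVAssembly.lipschitz_of_bounds` and
`B16Ineq141Solution`): with `‖K⁻¹P₀H*z‖ ≤ κ₁‖z‖` (the inverse bound `γ₀⁻¹2d(100M)⁵` of (1.9) times `‖H*‖`), `‖Hx‖ ≤ h₁‖x‖`,
`(δ/δA)V` `ℓ`-Lipschitz on the ball of radius `ρ` of `F` (*«Proposition 4 [15]»*), `h₁(R + ‖B̃′‖) ≤ ρ` and `κ₁ℓh₁ ≤ ½`, the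
map `B′ ↦ K⁻¹P₀H*((δ/δA)V)(HB′ + HB̃′)` is ½-Lipschitz on the ball `‖B′‖ ≤ R`. [cite: Balaban1989LargeFieldII, (1.40)–(1.41)
p.367; Balaban1985Variational, Prop. 4 p.293] -/
theorem lipschitz140_of_bounds {P₀ Kinv : E →ₗ[ℝ] E} (H : E →ₗ[ℝ] F) (Hst : F →ₗ[ℝ] E) (dV : F → F) (Bt : E)
    {κ₁ h₁ ℓ ρ R : ℝ} (hκ₁ : 0 ≤ κ₁) (hh₁ : 0 ≤ h₁) (hℓ : 0 ≤ ℓ)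
    (hKop : ∀ z : F, ‖Kinv (P₀ (Hst z))‖ ≤ κ₁ * ‖z‖) (hH : ∀ x : E, ‖H x‖ ≤ h₁ * ‖x‖)
    (hdV : ∀ u v : F, ‖u‖ ≤ ρ → ‖v‖ ≤ ρ → ‖dV u - dV v‖ ≤ ℓ * ‖u - v‖)
    (hρ : h₁ * (R + ‖Bt‖) ≤ ρ) (hsm : κ₁ * ℓ * h₁ ≤ 1 / 2) :
    ∀ x y : E, ‖x‖ ≤ R → ‖y‖ ≤ R →
      ‖Kinv (P₀ (Hst (dV (H x + H Bt)))) - Kinv (P₀ (Hst (dV (H y + H Bt))))‖ ≤ 1 / 2 * ‖x - y‖ := by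
  have harg : ∀ z : E, ‖z‖ ≤ R → ‖H z + H Bt‖ ≤ ρ := by
    intro z hz
    calc ‖H z + H Bt‖ ≤ ‖H z‖ + ‖H Bt‖ := norm_add_le _ _
      _ ≤ h₁ * ‖z‖ + h₁ * ‖Bt‖ := add_le_add (hH z) (hH Bt)
      _ ≤ h₁ * R + h₁ * ‖Bt‖ := by nlinarith
      _ = h₁ * (R + ‖Bt‖) := by ring
      _ ≤ ρ := hρ
  intro x y hx hy
  have e : Kinv (P₀ (Hst (dV (H x + H Bt)))) - Kinv (P₀ (Hst (dV (H y + H Bt)))) =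
      Kinv (P₀ (Hst (dV (H x + H Bt) - dV (H y + H Bt)))) := by
    simp only [map_sub]
  have h1 : ‖dV (H x + H Bt) - dV (H y + H Bt)‖ ≤ ℓ * ‖(H x + H Bt) - (H y + H Bt)‖ :=
    hdV _ _ (harg x hx) (harg y hy)
  have h2 : ‖(H x + H Bt) - (H y + H Bt)‖ ≤ h₁ * ‖x - y‖ := by
    have : (H x + H Bt) - (H y + H Bt) = H (x - y) := by rw [map_sub]; abel
    rw [this]; exact hH _
  rw [e]
  calc ‖Kinv (P₀ (Hst (dV (H x + H Bt) - dV (H y + H Bt))))‖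
      ≤ κ₁ * ‖dV (H x + H Bt) - dV (H y + H Bt)‖ := hKop _
    _ ≤ κ₁ * (ℓ * (h₁ * ‖x - y‖)) :=
        mul_le_mul_of_nonneg_left (h1.trans (mul_le_mul_of_nonneg_left h2 hℓ)) hκ₁
    _ = (κ₁ * ℓ * h₁) * ‖x - y‖ := by ring
    _ ≤ 1 / 2 * ‖x - y‖ := mul_le_mul_of_nonneg_right hsm (norm_nonneg _)

/-- **«Eq. (1.40) has exactly one solution» — uniqueness over `ℝ`**: two solutions `x`, `y` of (1.40) in a ball
`‖·‖ ≤ R` on which `B′ ↦ K⁻¹P₀H*((δ/δA)V)(HB′ + HB̃′)` is ½-Lipschitz (`lipschitz140_of_bounds`) coincide — their difference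
is minus the difference of the two values of that map, of norm at most half its own.  (The `ℂ`-analytic solution map
`B̃′ ↦ B′_Λ(B̃′)` with the bound (1.41) is `B16Ineq141Solution.exists_analytic_solution140`, row B16.Eq1.41.)
[cite: Balaban1989LargeFieldII, (1.40)–(1.41) p.367] -/
theorem solution140_unique_real {P₀ Kinv : E →ₗ[ℝ] E} (H : E →ₗ[ℝ] F) (Hst : F →ₗ[ℝ] E) (Δ₁ : F →ₗ[ℝ] F)
    (dV : F → F) (Bt : E) {R : ℝ}
    (hLip : ∀ x y : E, ‖x‖ ≤ R → ‖y‖ ≤ R →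
      ‖Kinv (P₀ (Hst (dV (H x + H Bt)))) - Kinv (P₀ (Hst (dV (H y + H Bt))))‖ ≤ 1 / 2 * ‖x - y‖)
    {x y : E} (hx : ‖x‖ ≤ R) (hy : ‖y‖ ≤ R)
    (hxe : x + Kinv (P₀ (Hst (dV (H x + H Bt)))) = -Kinv (P₀ (Hst (Δ₁ (H Bt)))))
    (hye : y + Kinv (P₀ (Hst (dV (H y + H Bt)))) = -Kinv (P₀ (Hst (Δ₁ (H Bt))))) : x = y := by
  have hsum : x - y + (Kinv (P₀ (Hst (dV (H x + H Bt)))) - Kinv (P₀ (Hst (dV (H y + H Bt))))) = 0 := by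
    have h : (x + Kinv (P₀ (Hst (dV (H x + H Bt))))) - (y + Kinv (P₀ (Hst (dV (H y + H Bt))))) = 0 := by
      rw [hxe, hye, sub_self]
    rw [← h]
    abel
  have e : x - y = -(Kinv (P₀ (Hst (dV (H x + H Bt)))) - Kinv (P₀ (Hst (dV (H y + H Bt))))) :=
    eq_neg_of_add_eq_zero_left hsum
  have hn : ‖x - y‖ ≤ 1 / 2 * ‖x - y‖ := by
    calc ‖x - y‖ = ‖Kinv (P₀ (Hst (dV (H x + H Bt)))) - Kinv (P₀ (Hst (dV (H y + H Bt))))‖ := by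
          rw [e, norm_neg]
      _ ≤ 1 / 2 * ‖x - y‖ := hLip x y hx hy
  have h0 : ‖x - y‖ = 0 := le_antisymm (by linarith [norm_nonneg (x - y)]) (norm_nonneg _)
  exact sub_eq_zero.1 (norm_eq_zero.1 h0)

/-- **Row B16.Eq1.42 — «This yields the formula V′_Λ(M̃^k(U′)) = exp iB′_Λ((1/i) log M̃^k(U′)) (1.42) for the function in the
identity (1.38)», PROVED in the model, in chart coordinates.**  Data and relations as in `eq140_of_isMinOn`; `B` = the chart
coordinate `(1/i) log V′_Λ(exp iB̃′)` of the (1.38)-defined `V′_Λ` — gauge-fixed (`hBg`: in the axial gauge `G₀` both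
`V_Λ(Ṽ′V)` and `V_Λ(V)` are gauge-fixed), strictly inside the minimisation ball (`hBr`, *«B′ is sufficiently small»*) and
minimising the (1.39) function `Φ` over the gauge-fixed ball (`hmin`: [IV] Prop. 1's minimum clause transported through
`X = V′·V_Λ(V)`, §1 `isMinOn_fun139_VΛ'138`); `BΛ` = a solution `B′_Λ(B̃′)` of (1.40) (`hBΛe`; row B16.Eq1.41) with both `B`,
`BΛ` in a ball `‖·‖ ≤ R` on which the (1.40) map is ½-Lipschitz (`hLip`, `lipschitz140_of_bounds`).  Conclusion: `B = B′_Λ(B̃′)`,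
i.e. `V′_Λ(exp iB̃′) = exp iB′_Λ(B̃′)`. [cite: Balaban1989LargeFieldII, (1.42) p.367] -/
theorem eq142_model {P₀ : E →ₗ[ℝ] E} (hP2 : ∀ x, P₀ (P₀ x) = P₀ x) (hPsa : ∀ x y, ⟪P₀ x, y⟫ = ⟪x, P₀ y⟫)
    (H : E →ₗ[ℝ] F) (Hst : F →ₗ[ℝ] E) (hadj : ∀ (x : E) (y : F), ⟪H x, y⟫ = ⟪x, Hst y⟫)
    (Δ₁ : F →ₗ[ℝ] F) (dV : F → F) (J : F) (Bt : E) {Kinv : E →ₗ[ℝ] E}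
    (hKl : ∀ x, Kinv (P₀ (Hst (Δ₁ (H (P₀ x))))) = P₀ x) (hKr : ∀ x, P₀ (Hst (Δ₁ (H (P₀ (Kinv x))))) = P₀ x)
    (hKP : ∀ x, Kinv (P₀ x) = Kinv x) {Φ : E → ℝ}
    (hΦ : ∀ X δ : E, HasDerivAt (fun s : ℝ => Φ (X + s • δ))
      (⟪δ, Hst J⟫ + ⟪δ, Hst (Δ₁ (H Bt))⟫ + ⟪δ, Hst (Δ₁ (H X))⟫ + ⟪δ, Hst (dV (H X + H Bt))⟫) 0)
    (hJ : ∀ δ : E, P₀ δ = δ → ⟪H δ, J⟫ = 0)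
    {B : E} {r R : ℝ} (hBg : P₀ B = B) (hBr : ‖B‖ < r)
    (hmin : IsMinOn Φ {B' : E | P₀ B' = B' ∧ ‖B'‖ ≤ r} B) (hBR : ‖B‖ ≤ R)
    (hLip : ∀ x y : E, ‖x‖ ≤ R → ‖y‖ ≤ R →
      ‖Kinv (P₀ (Hst (dV (H x + H Bt)))) - Kinv (P₀ (Hst (dV (H y + H Bt))))‖ ≤ 1 / 2 * ‖x - y‖)
    {BΛ : E} (hBΛR : ‖BΛ‖ ≤ R)
    (hBΛe : BΛ + Kinv (P₀ (Hst (dV (H BΛ + H Bt)))) = -Kinv (P₀ (Hst (Δ₁ (H Bt))))) : B = BΛ :=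
  solution140_unique_real H Hst Δ₁ dV Bt hLip hBR hBΛR
    (eq140_of_isMinOn hP2 hPsa H Hst hadj Δ₁ dV J Bt hKl hKr hKP hΦ hJ hBg hBr hmin) hBΛe

end Model

end Literature.MathematicalPhysics.QuantumFieldTheory.Balaban1983to89.B16Eq139CriticalPoint
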